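import Mathlib
import Summits.CriticalPhenomena.PercolationContinuityZ3.Theorems.PercNearOneGluingNoHeavyLowerTailIndicatorLawDefs
import HarnessLib

/-!
# Crux `NoHeavyLowerTail` (stmt-CriticalPhenomena-4575), line `one-cut-entropy-shearer` — the witness law `½ δ_⊤ + ½ Ber(q)^{⊗k}`

Route-task nh7-entropy (2026-08-18); definitions in `…IndicatorLawDefs.lean` (p177006), used by the no-go
`…IndicatorLawNoGo.lean`.  Facts about the product Bernoulli weights `berW k q` on `Finset (Fin k)` and the fake law
`fakeLaw k q = ½ δ_⊤ + ½ berW k q`: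

* `isPosAssocLaw_fakeLaw` — the fake law is log-supermodular (`fakeLaw_logSupermodular`: the product law is log-modular,
  `berW_mul`, and the top atom only ever sits at `s ⊔ t`), hence POSITIVELY ASSOCIATED by Mathlib's `fkg`
  (Fortuin–Kasteleyn–Ginibre 1971 on the distributive lattice `Finset (Fin k)`);
* `sum_fakeLaw` (mass `1`, binomial theorem), `sum_berW_mem` (`ν(i ∈ s) = q`), `sum_berW_mul_card` (`E_ν|s| = kq`),
  `markov_berW`, `berW_empty_le` (`(1−q)^k ≤ 1/(1+kq)`, Bernoulli);
* the four quantities the principle sees: `fakeLaw_empty_le` (reach), `fakeLaw_pair_le` (pair discordance `≤ q`),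
  `fakeLaw_mean_ge` (mean `≥ k/2`), `fakeLaw_bad_ge` (bad mass `≥ ½(1 − 1/(1+kq) − kq/θ)` below any threshold `θ > 0`).

Elementary bookkeeping; no percolation here.
-/

noncomputable section

namespace Summit.CriticalPhenomena.PercolationContinuityZ3.Theorems

open Finset
open scoped BigOperators Classical

/-! ## The counterexample law: `½ δ_⊤ + ½ Ber(1/r)^{⊗ r²}` -/

section Fake

variable {k : ℕ}

/-- The product weights are nonnegative for `0 ≤ q ≤ 1`. -/
theorem berW_nonneg {q : ℝ} (hq0 : 0 ≤ q) (hq1 : q ≤ 1) (s : Finset (Fin k)) : 0 ≤ berW k q s :=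
  mul_nonneg (pow_nonneg hq0 _) (pow_nonneg (by linarith) _)

/-- The fake law is nonnegative for `0 ≤ q ≤ 1`. -/
theorem fakeLaw_nonneg {q : ℝ} (hq0 : 0 ≤ q) (hq1 : q ≤ 1) (s : Finset (Fin k)) :
    0 ≤ fakeLaw k q s := by
  unfold fakeLaw
  have := berW_nonneg (k := k) hq0 hq1 s
  split_ifs <;> linarith

/-- The fake law dominates half the product law pointwise. -/
theorem half_berW_le_fakeLaw {q : ℝ} (s : Finset (Fin k)) : berW k q s / 2 ≤ fakeLaw k q s := by
  unfold fakeLaw; split_ifs <;> linarith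

/-- Total mass of the product weights is `1` (binomial theorem). -/
theorem sum_berW (q : ℝ) : ∑ s : Finset (Fin k), berW k q s = 1 := by
  have h := Fintype.sum_pow_mul_eq_add_pow (Fin k) q (1 - q)
  simp only [Fintype.card_fin] at h
  unfold berW
  rw [h, show q + (1 - q) = 1 by ring, one_pow]

/-- Total mass of the fake law is `1`. -/
theorem sum_fakeLaw (q : ℝ) : ∑ s : Finset (Fin k), fakeLaw k q s = 1 := by
  unfold fakeLaw
  rw [Finset.sum_add_distrib, ← Finset.sum_div, sum_berW]
  simp [Finset.sum_ite_eq']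
  norm_num

/-- The product weights are log-modular: `ν(s) ν(t) = ν(s ∩ t) ν(s ∪ t)`. -/
theorem berW_mul (q : ℝ) (s t : Finset (Fin k)) :
    berW k q s * berW k q t = berW k q (s ∩ t) * berW k q (s ∪ t) := by
  unfold berW
  have hc : s.card + t.card = (s ∩ t).card + (s ∪ t).card := by
    rw [Finset.card_inter_add_card_union]
  have hs : s.card ≤ k := by simpa using Finset.card_le_univ s
  have ht : t.card ≤ k := by simpa using Finset.card_le_univ t
  have hi : (s ∩ t).card ≤ k := by simpa using Finset.card_le_univ (s ∩ t)
  have hu : (s ∪ t).card ≤ k := by simpa using Finset.card_le_univ (s ∪ t)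
  have hc' : (k - s.card) + (k - t.card) = (k - (s ∩ t).card) + (k - (s ∪ t).card) := by omega
  calc q ^ s.card * (1 - q) ^ (k - s.card) * (q ^ t.card * (1 - q) ^ (k - t.card))
      = q ^ (s.card + t.card) * (1 - q) ^ ((k - s.card) + (k - t.card)) := by rw [pow_add, pow_add]; ring
    _ = q ^ ((s ∩ t).card + (s ∪ t).card) * (1 - q) ^ ((k - (s ∩ t).card) + (k - (s ∪ t).card)) := by
        rw [hc, hc']
    _ = _ := by rw [pow_add, pow_add]; ring

/-- The fake law is log-supermodular (FKG lattice condition). -/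
theorem fakeLaw_logSupermodular {q : ℝ} (hq0 : 0 ≤ q) (hq1 : q ≤ 1) (s t : Finset (Fin k)) :
    fakeLaw k q s * fakeLaw k q t ≤ fakeLaw k q (s ⊓ t) * fakeLaw k q (s ⊔ t) := by
  rw [Finset.inf_eq_inter, Finset.sup_eq_union]
  by_cases hs : s = univ
  · subst hs
    rw [Finset.univ_inter, Finset.union_eq_left.2 (Finset.subset_univ t), mul_comm]
  by_cases ht : t = univ
  · subst ht
    rw [Finset.inter_univ, Finset.union_eq_right.2 (Finset.subset_univ s)]
  have h1 : fakeLaw k q s * fakeLaw k q t = (berW k q (s ∩ t) / 2) * (berW k q (s ∪ t) / 2) := by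
    unfold fakeLaw; rw [if_neg hs, if_neg ht, zero_add, zero_add]
    rw [div_mul_div_comm, berW_mul, ← div_mul_div_comm]
  rw [h1]
  exact mul_le_mul (half_berW_le_fakeLaw _) (half_berW_le_fakeLaw _)
    (by have := berW_nonneg (k := k) hq0 hq1 (s ∪ t); linarith) (fakeLaw_nonneg hq0 hq1 _)

/-- The fake law is positively associated (Mathlib's `fkg` on the lattice `Finset (Fin k)`). -/
theorem isPosAssocLaw_fakeLaw {q : ℝ} (hq0 : 0 ≤ q) (hq1 : q ≤ 1) : IsPosAssocLaw (fakeLaw k q) := by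
  refine ⟨fakeLaw_nonneg hq0 hq1, fun U V hU hV => ?_⟩
  set f : Finset (Fin k) → ℝ := fun s => if s ∈ U then 1 else 0 with hf
  set g : Finset (Fin k) → ℝ := fun s => if s ∈ V then 1 else 0 with hg
  have hf0 : 0 ≤ f := fun s => by simp only [hf, Pi.zero_apply]; split_ifs <;> norm_num
  have hg0 : 0 ≤ g := fun s => by simp only [hg, Pi.zero_apply]; split_ifs <;> norm_num
  have hfm : Monotone f := by
    intro s t hst
    simp only [hf]
    by_cases h : s ∈ U
    · have : t ∈ U := hU hst h
      simp [h, this]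
    · simp only [h, if_false]; split_ifs <;> norm_num
  have hgm : Monotone g := by
    intro s t hst
    simp only [hg]
    by_cases h : s ∈ V
    · have : t ∈ V := hV hst h
      simp [h, this]
    · simp only [h, if_false]; split_ifs <;> norm_num
  have key := fkg f g (fakeLaw k q) (fakeLaw_nonneg hq0 hq1) hf0 hg0 hfm hgm
    (fakeLaw_logSupermodular hq0 hq1)
  have e1 : ∑ s, fakeLaw k q s * f s = ∑ s with s ∈ U, fakeLaw k q s := by
    simp only [hf, mul_ite, mul_one, mul_zero]
    rw [Finset.sum_filter]
  have e2 : ∑ s, fakeLaw k q s * g s = ∑ s with s ∈ V, fakeLaw k q s := by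
    simp only [hg, mul_ite, mul_one, mul_zero]
    rw [Finset.sum_filter]
  have e3 : ∑ s, fakeLaw k q s * (f s * g s) = ∑ s with (s ∈ U ∧ s ∈ V), fakeLaw k q s := by
    rw [Finset.sum_filter]
    refine Finset.sum_congr rfl fun s _ => ?_
    simp only [hf, hg]
    by_cases h1 : s ∈ U <;> by_cases h2 : s ∈ V <;> simp [h1, h2]
  rw [e1, e2, e3] at key
  exact key

/-! ### Quantitative facts about the product weights -/

/-- Configurations avoiding `i` are the subsets of `univ.erase i`. -/
theorem filter_not_mem_eq_powerset_erase (i : Fin k) :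
    (univ.filter fun s : Finset (Fin k) => i ∉ s) = (univ.erase i).powerset := by
  ext s
  simp only [Finset.mem_filter, Finset.mem_univ, true_and, Finset.mem_powerset]
  constructor
  · intro h x hx
    exact Finset.mem_erase.2 ⟨fun hxi => h (hxi ▸ hx), Finset.mem_univ x⟩
  · intro h hi
    have := h hi
    simp at this

/-- `ν(i ∉ s) = 1 - q`. -/
theorem sum_berW_not_mem (q : ℝ) (i : Fin k) :
    ∑ s with i ∉ s, berW k q s = 1 - q := by
  rw [filter_not_mem_eq_powerset_erase]
  have hcard : (univ.erase i).card = k - 1 := by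
    rw [Finset.card_erase_of_mem (Finset.mem_univ i), Finset.card_univ, Fintype.card_fin]
  have h := Finset.sum_pow_mul_eq_add_pow q (1 - q) (univ.erase i)
  rw [hcard] at h
  have h' : ∑ t ∈ (univ.erase i).powerset, berW k q t =
      (1 - q) * ∑ t ∈ (univ.erase i).powerset, q ^ t.card * (1 - q) ^ (k - 1 - t.card) := by
    rw [Finset.mul_sum]
    refine Finset.sum_congr rfl fun t ht => ?_
    have htc : t.card ≤ k - 1 := by
      have := Finset.card_le_card (Finset.mem_powerset.1 ht)
      rwa [hcard] at this
    have hk1 : 1 ≤ k := Nat.succ_le_of_lt (lt_of_le_of_lt (Nat.zero_le _) i.isLt)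
    have hexp : k - t.card = (k - 1 - t.card) + 1 := by omega
    unfold berW
    rw [hexp, pow_succ]
    ring
  rw [h', h, show q + (1 - q) = 1 by ring, one_pow, mul_one]

/-- `ν(i ∈ s) = q`. -/
theorem sum_berW_mem (q : ℝ) (i : Fin k) :
    ∑ s with i ∈ s, berW k q s = q := by
  have hsplit := Finset.sum_filter_add_sum_filter_not (univ : Finset (Finset (Fin k)))
    (fun s => i ∈ s) (berW k q)
  rw [sum_berW, sum_berW_not_mem] at hsplit
  linarith

/-- `E_ν |s| = k q`. -/
theorem sum_berW_mul_card (q : ℝ) :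
    ∑ s : Finset (Fin k), berW k q s * s.card = k * q := by
  have hcard : ∀ s : Finset (Fin k), (s.card : ℝ) = ∑ i : Fin k, if i ∈ s then (1 : ℝ) else 0 := by
    intro s
    rw [Finset.sum_boole]
    simp
  simp_rw [hcard, Finset.mul_sum]
  rw [Finset.sum_comm]
  have : ∀ i : Fin k, ∑ s : Finset (Fin k), berW k q s * (if i ∈ s then (1 : ℝ) else 0) = q := by
    intro i
    simp_rw [mul_ite, mul_one, mul_zero]
    rw [← Finset.sum_filter]
    exact sum_berW_mem q i
  simp_rw [this]
  simp

/-- Markov: `θ · ν(|s| ≥ θ) ≤ k q`. -/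
theorem markov_berW {q : ℝ} (hq0 : 0 ≤ q) (hq1 : q ≤ 1) (θ : ℝ) :
    θ * ∑ s with θ ≤ (s.card : ℝ), berW k q s ≤ k * q := by
  rw [← sum_berW_mul_card q, Finset.mul_sum]
  calc ∑ s with θ ≤ (s.card : ℝ), θ * berW k q s
      ≤ ∑ s with θ ≤ (s.card : ℝ), berW k q s * s.card := by
        refine Finset.sum_le_sum fun s hs => ?_
        have hθs : θ ≤ s.card := (Finset.mem_filter.1 hs).2
        rw [mul_comm]
        exact mul_le_mul_of_nonneg_left hθs (berW_nonneg hq0 hq1 s)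
    _ ≤ ∑ s, berW k q s * s.card :=
        Finset.sum_le_univ_sum_of_nonneg fun s => mul_nonneg (berW_nonneg hq0 hq1 s) (Nat.cast_nonneg _)

/-- `ν(∅) = (1-q)^k ≤ 1/(1 + k q)` (Bernoulli's inequality). -/
theorem berW_empty_le {q : ℝ} (hq0 : 0 ≤ q) (hq1 : q ≤ 1) :
    berW k q ∅ ≤ 1 / (1 + k * q) := by
  unfold berW
  simp only [Finset.card_empty, pow_zero, one_mul, Nat.sub_zero]
  have hpos : 0 < 1 + (k : ℝ) * q := by positivity
  have hB : 1 + (k : ℝ) * q ≤ (1 + q) ^ k := one_add_mul_le_pow (by linarith) k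
  have hprod : (1 - q) ^ k * (1 + q) ^ k ≤ 1 := by
    rw [← mul_pow]
    exact pow_le_one₀ (by nlinarith) (by nlinarith)
  rw [le_div_iff₀ hpos]
  calc (1 - q) ^ k * (1 + ↑k * q) ≤ (1 - q) ^ k * (1 + q) ^ k :=
        mul_le_mul_of_nonneg_left hB (pow_nonneg (by linarith) _)
    _ ≤ 1 := hprod

/-! ### The fake law against the hypotheses of the principle -/

/-- `univ ≠ ∅` in `Finset (Fin k)` for `k ≥ 1`. -/
theorem univ_ne_empty_fin (hk : 1 ≤ k) : (univ : Finset (Fin k)) ≠ ∅ := by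
  rw [← Finset.nonempty_iff_ne_empty]
  exact ⟨⟨0, hk⟩, Finset.mem_univ _⟩

/-- Reach: `p(∅) ≤ 1/(2(1 + kq))`. -/
theorem fakeLaw_empty_le (hk : 1 ≤ k) {q : ℝ} (hq0 : 0 ≤ q) (hq1 : q ≤ 1) :
    fakeLaw k q ∅ ≤ 1 / (1 + k * q) / 2 := by
  unfold fakeLaw
  rw [if_neg (Ne.symm (univ_ne_empty_fin hk)), zero_add]
  have := berW_empty_le (k := k) hq0 hq1
  linarith

/-- Pair discordance: `p((i ∈ s) ≠ (j ∈ s)) ≤ q`. -/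
theorem fakeLaw_pair_le {q : ℝ} (hq0 : 0 ≤ q) (hq1 : q ≤ 1) (i j : Fin k) :
    (∑ s with ((i ∈ s ∧ j ∉ s) ∨ (j ∈ s ∧ i ∉ s)), fakeLaw k q s) ≤ q := by
  have hne : ∀ s ∈ (univ.filter fun s : Finset (Fin k) => (i ∈ s ∧ j ∉ s) ∨ (j ∈ s ∧ i ∉ s)),
      fakeLaw k q s = berW k q s / 2 := by
    intro s hs
    have hs' := (Finset.mem_filter.1 hs).2
    have hsu : s ≠ univ := by
      rintro rfl
      rcases hs' with ⟨-, h⟩ | ⟨-, h⟩ <;> exact h (Finset.mem_univ _)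
    unfold fakeLaw; rw [if_neg hsu, zero_add]
  rw [Finset.sum_congr rfl hne, ← Finset.sum_div]
  have hsub : (univ.filter fun s : Finset (Fin k) => (i ∈ s ∧ j ∉ s) ∨ (j ∈ s ∧ i ∉ s)) ⊆
      (univ.filter fun s : Finset (Fin k) => i ∈ s) ∪ (univ.filter fun s : Finset (Fin k) => j ∈ s) := by
    intro s hs
    rcases (Finset.mem_filter.1 hs).2 with ⟨h, -⟩ | ⟨h, -⟩
    · exact Finset.mem_union_left _ (Finset.mem_filter.2 ⟨Finset.mem_univ _, h⟩)
    · exact Finset.mem_union_right _ (Finset.mem_filter.2 ⟨Finset.mem_univ _, h⟩)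
  have h1 : ∑ s ∈ (univ.filter fun s : Finset (Fin k) => (i ∈ s ∧ j ∉ s) ∨ (j ∈ s ∧ i ∉ s)), berW k q s
      ≤ ∑ s ∈ (univ.filter fun s : Finset (Fin k) => i ∈ s) ∪ (univ.filter fun s : Finset (Fin k) => j ∈ s),
          berW k q s :=
    Finset.sum_le_sum_of_subset_of_nonneg hsub fun s _ _ => berW_nonneg hq0 hq1 s
  have h2 : ∑ s ∈ (univ.filter fun s : Finset (Fin k) => i ∈ s) ∪ (univ.filter fun s : Finset (Fin k) => j ∈ s),
          berW k q s ≤ q + q := by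
    have hu := Finset.sum_union_inter (s₁ := univ.filter fun s : Finset (Fin k) => i ∈ s)
      (s₂ := univ.filter fun s : Finset (Fin k) => j ∈ s) (f := berW k q)
    rw [sum_berW_mem, sum_berW_mem] at hu
    have hnn : 0 ≤ ∑ s ∈ (univ.filter fun s : Finset (Fin k) => i ∈ s) ∩ (univ.filter fun s : Finset (Fin k) => j ∈ s),
        berW k q s := Finset.sum_nonneg fun s _ => berW_nonneg hq0 hq1 s
    linarith
  have : (∑ s ∈ (univ.filter fun s : Finset (Fin k) => (i ∈ s ∧ j ∉ s) ∨ (j ∈ s ∧ i ∉ s)), berW k q s) / 2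
      ≤ (q + q) / 2 := by gcongr; exact h1.trans h2
  linarith

/-- The mean is at least `k/2` (top atom alone). -/
theorem fakeLaw_mean_ge {q : ℝ} (hq0 : 0 ≤ q) (hq1 : q ≤ 1) :
    (k : ℝ) / 2 ≤ ∑ i : Fin k, ∑ u with i ∈ u, fakeLaw k q u := by
  have h : ∀ i : Fin k, (1 / 2 : ℝ) ≤ ∑ u with i ∈ u, fakeLaw k q u := by
    intro i
    have hmem : (univ : Finset (Fin k)) ∈ (univ.filter fun u : Finset (Fin k) => i ∈ u) :=
      Finset.mem_filter.2 ⟨Finset.mem_univ _, Finset.mem_univ _⟩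
    have h1 : fakeLaw k q univ ≤ ∑ u with i ∈ u, fakeLaw k q u :=
      Finset.single_le_sum (fun u _ => fakeLaw_nonneg hq0 hq1 u) hmem
    have h2 : (1 / 2 : ℝ) ≤ fakeLaw k q univ := by
      unfold fakeLaw; rw [if_pos rfl]
      have := berW_nonneg (k := k) hq0 hq1 univ
      linarith
    exact h2.trans h1
  calc (k : ℝ) / 2 = ∑ _i : Fin k, (1 / 2 : ℝ) := by simp; ring
    _ ≤ _ := Finset.sum_le_sum fun i _ => h i

/-- Lower bound for the bad mass of the fake law: for `θ > 0`,
`p(1 ≤ |s| < θ) ≥ ½ (1 - 1/(1+kq) - kq/θ)`. -/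
theorem fakeLaw_bad_ge {q : ℝ} (hq0 : 0 ≤ q) (hq1 : q ≤ 1) {θ : ℝ} (hθ : 0 < θ) :
    (1 - 1 / (1 + k * q) - k * q / θ) / 2 ≤
      ∑ s with (1 ≤ s.card ∧ (s.card : ℝ) < θ), fakeLaw k q s := by
  -- pass to the product weights
  have hle : ∑ s with (1 ≤ s.card ∧ (s.card : ℝ) < θ), berW k q s / 2 ≤
      ∑ s with (1 ≤ s.card ∧ (s.card : ℝ) < θ), fakeLaw k q s :=
    Finset.sum_le_sum fun s _ => half_berW_le_fakeLaw s
  refine le_trans ?_ hle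
  rw [← Finset.sum_div]
  gcongr
  -- split the total mass `1`
  have hsplit := Finset.sum_filter_add_sum_filter_not (univ : Finset (Finset (Fin k)))
    (fun s => 1 ≤ s.card ∧ (s.card : ℝ) < θ) (berW k q)
  rw [sum_berW] at hsplit
  -- the complement lies in `{∅} ∪ {θ ≤ |s|}`
  have hsub : (univ.filter fun s : Finset (Fin k) => ¬ (1 ≤ s.card ∧ (s.card : ℝ) < θ)) ⊆
      {∅} ∪ (univ.filter fun s : Finset (Fin k) => θ ≤ (s.card : ℝ)) := by
    intro s hs
    have h := (Finset.mem_filter.1 hs).2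
    by_cases h0 : s = ∅
    · exact Finset.mem_union_left _ (Finset.mem_singleton.2 h0)
    · refine Finset.mem_union_right _ (Finset.mem_filter.2 ⟨Finset.mem_univ _, ?_⟩)
      have h1 : 1 ≤ s.card := Finset.card_pos.2 (Finset.nonempty_iff_ne_empty.2 h0)
      by_contra hlt
      exact h ⟨h1, lt_of_not_ge hlt⟩
  have hcomp : ∑ s ∈ (univ.filter fun s : Finset (Fin k) => ¬ (1 ≤ s.card ∧ (s.card : ℝ) < θ)), berW k q s
      ≤ berW k q ∅ + ∑ s with θ ≤ (s.card : ℝ), berW k q s := by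
    refine (Finset.sum_le_sum_of_subset_of_nonneg hsub fun s _ _ => berW_nonneg hq0 hq1 s).trans ?_
    have hu := Finset.sum_union_inter (s₁ := ({∅} : Finset (Finset (Fin k))))
      (s₂ := univ.filter fun s : Finset (Fin k) => θ ≤ (s.card : ℝ)) (f := berW k q)
    have hnn : 0 ≤ ∑ s ∈ ({∅} : Finset (Finset (Fin k))) ∩ (univ.filter fun s : Finset (Fin k) => θ ≤ (s.card : ℝ)),
        berW k q s := Finset.sum_nonneg fun s _ => berW_nonneg hq0 hq1 s
    rw [Finset.sum_singleton] at hu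
    linarith
  have hM := markov_berW (k := k) hq0 hq1 θ
  have hM' : ∑ s with θ ≤ (s.card : ℝ), berW k q s ≤ k * q / θ := by
    rw [le_div_iff₀ hθ, mul_comm]; exact hM
  have hE := berW_empty_le (k := k) hq0 hq1
  linarith

end Fake

end Summit.CriticalPhenomena.PercolationContinuityZ3.Theorems
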